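import Summits.CriticalPhenomena.PercolationContinuityZ3.Theorems.SahiGridPatternOrderNThree
import Summits.CriticalPhenomena.PercolationContinuityZ3.Theorems.PercNearOneGluingNoHeavyLowerTailAntipodalHarris

/-!
# The order-2 pattern inequality holds in every dimension: `PatternPosN 2 d` (antipodal Harris)

Support file (Sahi cell `prim-sahi`, seat `prim-sahi-typer`, generation 26; `--supports stmt-CriticalPhenomena-4575`).  Pure
proofs (two bookkeeping definitions: the support `supp` of a point of `[2]^d` and its antipode `flipPt`), no `sorry`, standard
axioms.

At order `2` the permutation patterns of `[2]^d` are the ANTIPODAL PAIRS `(p, p̄)` of the Boolean cube, and the recursive kernel is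
`K_2(M) = M₁₁M₀₁ − M₁₁M₀₀` (`copyKernel_two`), so
  `sStarN 2 d (A_0, A_1) = #(A_0 ∩ A_1) − #{p ∈ A_0 : p̄ ∈ A_1}`   (`sStarN_two_eq`).
For up-sets this is nonnegative by the antipodal Harris inequality `#{Y ∈ 𝒜 : Yᶜ ∈ ℬ} ≤ #(𝒜 ∩ ℬ)` of the tree
(`AntipodalHarris.card_inter_antipode_le`, Harris–Kleitman twice), transported along the support map
`[2]^d ≃ 2^{[d]}`.  Hence **`patternPosN_two : PatternPosN 2 d` for every `d`** — the order-2 row of the pattern programme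
(coefficientwise positivity of the homogeneous covariance form `Z²E₂` of a product weight on every grid, the fibrewise /
"RLS" form of Harris' inequality; cf. `four_functions_fibre` in the tree for general distributive lattices), so that with
`patternPosN_zero`, `patternPosN_one`, `patternPosN_three_of_le_three` the settled cells of the order-`n` pattern programme
are `n ≤ 2` (every `d`) and `(n,d) = (3, ≤ 3)`, all kernel-only. [this work]
-/

namespace Summit.CriticalPhenomena.PercolationContinuityZ3.Theorems.SahiGridPatternN

open Finset Literature.Probability.LatticeModels
open SahiCopyKernel (copyKernel incMatrix)
open SahiGrid3 (ind)
open AntipodalHarris (antipode mem_antipode card_inter_antipode_le)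
open scoped BigOperators

variable {d : ℕ}

/-! ### Points of `[2]^d` as subsets of `[d]` -/

/-- The support `{a : p a = 1}` of a point of `[2]^d`. [this work] -/
def supp (p : Pn 2 d) : Finset (Fin d) := univ.filter fun a => p a = 1

/-- The point of `[2]^d` with a given support. [this work] -/
def ptOf (S : Finset (Fin d)) : Pn 2 d := fun a => if a ∈ S then 1 else 0

/-- In `Fin 2`, not `1` means `0`. [folklore] -/
theorem fin_two_eq_zero_of_ne_one {x : Fin 2} (h : x ≠ 1) : x = 0 := by
  revert x; decide

/-- `supp (ptOf S) = S`. [this work] -/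
theorem supp_ptOf (S : Finset (Fin d)) : supp (ptOf S) = S := by
  ext a
  unfold supp ptOf
  simp only [mem_filter, mem_univ, true_and]
  by_cases h : a ∈ S <;> simp [h]

/-- `ptOf (supp p) = p`. [this work] -/
theorem ptOf_supp (p : Pn 2 d) : ptOf (supp p) = p := by
  funext a
  unfold supp ptOf
  simp only [mem_filter, mem_univ, true_and]
  by_cases h : p a = 1
  · simp [h]
  · simp [fin_two_eq_zero_of_ne_one h]

/-- `supp` is injective. [this work] -/
theorem supp_injective : Function.Injective (supp : Pn 2 d → Finset (Fin d)) :=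
  fun p q h => by rw [← ptOf_supp p, ← ptOf_supp q, h]

/-- `supp` is monotone: `p ≤ q → supp p ⊆ supp q`. [this work] -/
theorem supp_mono {p q : Pn 2 d} (h : p ≤ q) : supp p ⊆ supp q := by
  intro a ha
  unfold supp at ha ⊢
  rw [mem_filter] at ha ⊢
  refine ⟨mem_univ _, le_antisymm (Fin.le_last _) ?_⟩
  have := h a
  rw [ha.2] at this
  exact this

/-- `ptOf` is monotone: `S ⊆ T → ptOf S ≤ ptOf T`. [this work] -/
theorem ptOf_mono {S T : Finset (Fin d)} (h : S ⊆ T) : ptOf S ≤ ptOf T := by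
  intro a
  unfold ptOf
  by_cases hS : a ∈ S
  · simp [hS, h hS]
  · simp [hS]

/-- The antipode `p̄ a = 1 − p a` of a point of `[2]^d`. [this work] -/
def flipPt (p : Pn 2 d) : Pn 2 d := fun a => Fin.rev (p a)

/-- `flipPt` is an involution. [this work] -/
theorem flipPt_flipPt (p : Pn 2 d) : flipPt (flipPt p) = p := by
  funext a; simp [flipPt, Fin.rev_rev]

/-- The support of the antipode is the complement of the support. [this work] -/
theorem supp_flipPt (p : Pn 2 d) : supp (flipPt p) = (supp p)ᶜ := by
  ext a
  unfold supp flipPt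
  simp only [mem_filter, mem_univ, true_and, mem_compl]
  constructor
  · intro h h1
    rw [h1] at h
    exact absurd h (by decide)
  · intro h
    rw [fin_two_eq_zero_of_ne_one h]
    decide

/-- `ptOf Sᶜ` is the antipode of `ptOf S`. [this work] -/
theorem ptOf_compl (S : Finset (Fin d)) : ptOf Sᶜ = flipPt (ptOf S) := by
  funext a
  unfold ptOf flipPt
  by_cases h : a ∈ S
  · simp only [mem_compl, h, not_true_eq_false, ↓reduceIte]; decide
  · simp only [mem_compl, h, not_false_eq_true, ↓reduceIte]; decide

/-- `Σ_p 1_U(p) 1_V(p) = #(U ∩ V)` (plumbing). [folklore] -/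
theorem sum_ind_mul_ind {Y : Type*} [Fintype Y] [DecidableEq Y] (U V : Finset Y) :
    ∑ p, ind U p * ind V p = ((U ∩ V).card : ℤ) := by
  have h : ∀ p, ind U p * ind V p = if p ∈ U ∩ V then (1 : ℤ) else 0 := by
    intro p
    unfold ind
    by_cases hU : p ∈ U <;> by_cases hV : p ∈ V <;> simp [hU, hV, mem_inter]
  simp_rw [h]
  rw [Finset.sum_boole, Finset.filter_univ_mem]

/-- The image family `supp '' A` of a set of points. [this work] -/
def fam (A : Finset (Pn 2 d)) : Finset (Finset (Fin d)) := A.map ⟨supp, supp_injective⟩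

/-- Membership in the image family. [this work] -/
theorem mem_fam {A : Finset (Pn 2 d)} {S : Finset (Fin d)} : S ∈ fam A ↔ ptOf S ∈ A := by
  unfold fam
  rw [mem_map]
  constructor
  · rintro ⟨p, hp, rfl⟩
    show ptOf (supp p) ∈ A
    rwa [ptOf_supp]
  · intro h
    exact ⟨ptOf S, h, supp_ptOf S⟩

/-- `supp p ∈ fam A ↔ p ∈ A`. [this work] -/
theorem supp_mem_fam {A : Finset (Pn 2 d)} {p : Pn 2 d} : supp p ∈ fam A ↔ p ∈ A := by
  rw [mem_fam, ptOf_supp]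

/-- The image family of an up-set of points is an up-set of the Boolean lattice. [this work] -/
theorem isUpperSet_fam {A : Finset (Pn 2 d)} (hA : IsUpperSet (A : Set (Pn 2 d))) :
    IsUpperSet (fam A : Set (Finset (Fin d))) := by
  intro S T hST hS
  rw [Finset.mem_coe, mem_fam] at hS ⊢
  exact hA (ptOf_mono hST) hS

/-- `#(fam A ∩ fam B) = #(A ∩ B)`. [this work] -/
theorem card_fam_inter (A B : Finset (Pn 2 d)) : (fam A ∩ fam B).card = (A ∩ B).card := by
  rw [show fam A ∩ fam B = fam (A ∩ B) from ?_]
  · exact card_map _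
  · ext S; simp only [mem_inter, mem_fam]

/-- `#(fam A ∩ antipode (fam B)) = #{p ∈ A : p̄ ∈ B}`. [this work] -/
theorem card_fam_inter_antipode (A B : Finset (Pn 2 d)) :
    (fam A ∩ antipode (fam B)).card = (A.filter fun p => flipPt p ∈ B).card := by
  rw [show fam A ∩ antipode (fam B) = fam (A.filter fun p => flipPt p ∈ B) from ?_]
  · exact card_map _
  · ext S
    simp only [mem_inter, mem_fam, mem_antipode, mem_filter, ptOf_compl]

/-- **Antipodal Harris on `[2]^d`**: for up-sets `A, B` of the Boolean cube, `#{p ∈ A : p̄ ∈ B} ≤ #(A ∩ B)`. [this work] -/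
theorem card_filter_flipPt_le (A B : Finset (Pn 2 d)) (hA : IsUpperSet (A : Set (Pn 2 d)))
    (hB : IsUpperSet (B : Set (Pn 2 d))) : (A.filter fun p => flipPt p ∈ B).card ≤ (A ∩ B).card := by
  rw [← card_fam_inter_antipode, ← card_fam_inter]
  exact card_inter_antipode_le (isUpperSet_fam hA) (isUpperSet_fam hB)

/-! ### The order-2 pattern functional -/

/-- A permutation of `Fin 2` sends `1` to the antipode of where it sends `0`. [folklore] -/
theorem perm_two_apply_one (σ : Equiv.Perm (Fin 2)) : σ 1 = Fin.rev (σ 0) := by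
  have h : σ 1 ≠ σ 0 := fun h => absurd (σ.injective h) (by decide)
  revert h
  generalize σ 1 = x, σ 0 = y
  revert x y; decide

/-- The second point of an order-2 pattern is the antipode of the first. [this work] -/
theorem col_one_eq_flipPt (π : Fin d → Equiv.Perm (Fin 2)) : col π 1 = flipPt (col π 0) := by
  funext a
  exact perm_two_apply_one (π a)

/-- The permutations of `Fin 2` ↔ their value at `0`. [this work] -/
def permTwoEquiv : Equiv.Perm (Fin 2) ≃ Fin 2 where
  toFun σ := σ 0
  invFun i := if i = 0 then Equiv.refl _ else Equiv.swap 0 1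
  left_inv σ := by
    refine Equiv.ext fun x => ?_
    have h1 := perm_two_apply_one σ
    by_cases h0 : σ 0 = 0
    · have hinv : (if σ 0 = 0 then Equiv.refl (Fin 2) else Equiv.swap 0 1) = Equiv.refl _ := by rw [if_pos h0]
      show (if σ 0 = 0 then Equiv.refl (Fin 2) else Equiv.swap 0 1) x = σ x
      rw [hinv, Equiv.refl_apply]
      revert x
      rw [Fin.forall_fin_two]
      exact ⟨h0.symm, by rw [h1, h0]; decide⟩
    · have h0' : σ 0 = 1 := by
        by_contra hc
        exact h0 (fin_two_eq_zero_of_ne_one hc)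
      have hinv : (if σ 0 = 0 then Equiv.refl (Fin 2) else Equiv.swap 0 1) = Equiv.swap 0 1 := by rw [if_neg h0]
      show (if σ 0 = 0 then Equiv.refl (Fin 2) else Equiv.swap 0 1) x = σ x
      rw [hinv]
      revert x
      rw [Fin.forall_fin_two]
      exact ⟨by rw [Equiv.swap_apply_left, h0'], by rw [Equiv.swap_apply_right, h1, h0']; decide⟩
  right_inv i := by
    revert i; decide

/-- The order-2 patterns of `[2]^d` ↔ the points of `[2]^d` (first point of the pattern). [this work] -/
def patternTwoEquiv : (Fin d → Equiv.Perm (Fin 2)) ≃ Pn 2 d := Equiv.piCongrRight fun _ => permTwoEquiv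

/-- `patternTwoEquiv π = col π 0`. [this work] -/
theorem patternTwoEquiv_apply (π : Fin d → Equiv.Perm (Fin 2)) : patternTwoEquiv π = col π 0 := rfl

/-- **`sStarN 2 d A = #(A_0 ∩ A_1) − #{p ∈ A_0 : p̄ ∈ A_1}`.** [this work] -/
theorem sStarN_two_eq (A : Fin 2 → Finset (Pn 2 d)) :
    sStarN 2 d A = ((A 0 ∩ A 1).card : ℤ) - (((A 0).filter fun p => flipPt p ∈ A 1).card : ℤ) := by
  unfold sStarN
  have hterm : ∀ π : Fin d → Equiv.Perm (Fin 2), copyKernel 2 (incMatrix A (col π)) =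
      ind (A 0) (flipPt (patternTwoEquiv π)) * ind (A 1) (flipPt (patternTwoEquiv π)) -
        ind (A 0) (patternTwoEquiv π) * ind (A 1) (flipPt (patternTwoEquiv π)) := by
    intro π
    rw [copyKernel_two, patternTwoEquiv_apply, ← col_one_eq_flipPt]
    show ind (A 1) (col π 1) * ind (A 0) (col π 1) - ind (A 1) (col π 1) * ind (A 0) (col π 0) = _
    ring
  simp_rw [hterm]
  rw [Equiv.sum_comp patternTwoEquiv (fun p => ind (A 0) (flipPt p) * ind (A 1) (flipPt p) -
    ind (A 0) p * ind (A 1) (flipPt p)), Finset.sum_sub_distrib]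
  congr 1
  · -- Σ_p 1_{A0}(p̄) 1_{A1}(p̄) = #(A0 ∩ A1): re-index by the involution p ↦ p̄
    have hflip : Function.Bijective (flipPt : Pn 2 d → Pn 2 d) :=
      Function.Involutive.bijective flipPt_flipPt
    show ∑ p, (fun q => ind (A 0) q * ind (A 1) q) ((Equiv.ofBijective _ hflip) p) = _
    rw [Equiv.sum_comp (Equiv.ofBijective _ hflip) (fun q => ind (A 0) q * ind (A 1) q)]
    exact sum_ind_mul_ind (A 0) (A 1)
  · -- Σ_p 1_{A0}(p) 1_{A1}(p̄) = #{p ∈ A0 : p̄ ∈ A1}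
    have h : ∀ p : Pn 2 d, ind (A 0) p * ind (A 1) (flipPt p) =
        if p ∈ (A 0).filter (fun p => flipPt p ∈ A 1) then (1 : ℤ) else 0 := by
      intro p
      unfold ind
      by_cases h0 : p ∈ A 0 <;> by_cases h1 : flipPt p ∈ A 1 <;> simp [h0, h1, mem_filter]
    simp_rw [h]
    rw [Finset.sum_boole, Finset.filter_univ_mem]

/-- **`PatternPosN 2 d` in every dimension** (antipodal Harris): the order-2 row of the pattern programme. [this work] -/
theorem patternPosN_two (d : ℕ) : PatternPosN 2 d := by
  intro A hA
  rw [sStarN_two_eq]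
  have h := card_filter_flipPt_le (A 0) (A 1) (hA 0) (hA 1)
  omega

/-- The settled orders `n ≤ 2` in every dimension, bundled. [this work] -/
theorem patternPosN_of_le_two {n : ℕ} (hn : n ≤ 2) (d : ℕ) : PatternPosN n d := by
  interval_cases n
  · exact patternPosN_zero d
  · exact patternPosN_one d
  · exact patternPosN_two d

end Summit.CriticalPhenomena.PercolationContinuityZ3.Theorems.SahiGridPatternN
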